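import Mathlib
import Summits.NavierStokesRegularity.NavierStokesRegularity.Theorems.FilamentSkeletonRssStadiumDeviationReflect
import Summits.NavierStokesRegularity.NavierStokesRegularity.Theorems.FilamentSkeletonRssStadiumPartnerPiece

/-!
# Route `FilamentSkeletonRss` · twin child cruxes `TangentSkeletonNearStraight` (stmt-28295) / `TangentSkeletonNearStraightL` (stmt-23320) ·
# shared registered stub `stub_stripPropagation : StripPropagation` — brick: POINT REFLECTION THROUGH THE STADIUM CENTRE (left half from the right)

The quarter-width corner certificates (hands leafhand-15: `Theorems.StadiumCornerLeft`, `Theorems.StadiumCornerRightNear`, …) are stated for targets in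
the RIGHT half (`cc ≤ x₀`) of the stadium `S = {|Im z| < hs, |Re z − cc| < L + hs}`.  The holomorphic point reflection `ρ w = 2cc − w` through the
CENTRE maps `S` onto itself (`Theorems.StadiumDeviationReflect.reflect_mem_iff` at `x = cc`) and transports EVERY per-filament hypothesis of the
stub to the reflected data `F ∘ ρ`, `G ∘ ρ`, `X ∘ (2cc − ·)`, `A ∘ (2cc − ·)` (§2: holomorphy, `deriv (F∘ρ) = −F′∘ρ`, `‖(F∘ρ)′‖ ≤ M`, `Σ((F∘ρ)′)ᵢ² = 1`,
real traces, unit speed / tangent oscillation / `C²` of the reversed curve, the core-area bounds), while the matched-kernel base is literally the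
same expression at reflected target and source (§3, `rfl` bookkeeping: `ρ(x₀ + iY) = (2cc − x₀) + i(−Y)`).  Together with the conjugation symmetry
(`Theorems.StadiumSchwarzReflection`) this reduces all four corners of the output stadium to the upper-right one.
HONEST FRAMING: a bookkeeping brick for a HYPOTHETICAL filament skeleton on the NEGATIVE side of a MODEL route; no stub of 28295 / 23320 is closed
here; nothing here bears on Navier–Stokes regularity or blow-up.  `--supports stmt-NavierStokesRegularity-28295`.
-/

set_option linter.dupNamespace false

noncomputable section

namespace Summit.NavierStokesRegularity.NavierStokesRegularity.Theorems.StadiumCentreReflection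

open Set Complex
open scoped InnerProductSpace
open Summit.NavierStokesRegularity.NavierStokesRegularity.Theorems.StadiumDeviationReflect
open Summit.NavierStokesRegularity.NavierStokesRegularity.Theorems.StadiumPartnerPiece

/-! ## §1  The reflection through the centre preserves the stadium -/

/-- `2cc − w ∈ S ↔ w ∈ S` for the stadium centred at `cc`. [folklore] -/
theorem reflect_centre_mem_iff {hs L cc : ℝ} (w : ℂ) :
    (2 * (cc : ℂ) - w) ∈ {z : ℂ | |z.im| < hs ∧ |z.re - cc| < L + hs} ↔ w ∈ {z : ℂ | |z.im| < hs ∧ |z.re - cc| < L + hs} := by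
  have h := reflect_mem_iff (hs := hs) (L := L) (cc := cc) (x := cc) w
  rw [show 2 * cc - cc = cc by ring] at h
  exact h

/-- The reflection has derivative `−1`. [folklore] -/
theorem hasDerivAt_reflect (cc : ℝ) (w : ℂ) : HasDerivAt (fun w : ℂ => 2 * (cc : ℂ) - w) (-1) w := by
  simpa using (hasDerivAt_id w).const_sub (2 * (cc : ℂ))

/-- The reflection on real points: `2cc − r` is real. [folklore] -/
theorem reflect_ofReal (cc r : ℝ) : 2 * (cc : ℂ) - (r : ℂ) = ((2 * cc - r : ℝ) : ℂ) := by push_cast; ring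

/-- The reflection of a target `x₀ + iY` is the target `(2cc − x₀) + i(−Y)`; its real part is `2cc − Re`, its imaginary part `−Im`. [folklore] -/
theorem reflect_target (cc x₀ Y : ℝ) (w : ℂ) :
    2 * (cc : ℂ) - ((x₀ : ℂ) + (Y : ℂ) * I) = ((2 * cc - x₀ : ℝ) : ℂ) + ((-Y : ℝ) : ℂ) * I ∧
    (2 * (cc : ℂ) - w).re = 2 * cc - w.re ∧ (2 * (cc : ℂ) - w).im = -w.im := by
  refine ⟨?_, by simp, by simp⟩
  apply Complex.ext <;> simp

/-! ## §2  Transport of the per-filament hypotheses -/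

/-- **Holomorphy** of `F ∘ ρ` on the stadium. [folklore] -/
theorem reflected_differentiableOn {E : Type*} [NormedAddCommGroup E] [NormedSpace ℂ E] {hs L cc : ℝ} {F : ℂ → E}
    (hF : DifferentiableOn ℂ F {z : ℂ | |z.im| < hs ∧ |z.re - cc| < L + hs}) :
    DifferentiableOn ℂ (fun w => F (2 * (cc : ℂ) - w)) {z : ℂ | |z.im| < hs ∧ |z.re - cc| < L + hs} := by
  intro w hw
  have h1 : DifferentiableAt ℂ F (2 * (cc : ℂ) - w) :=
    hF.differentiableAt ((isOpen_stadium hs (L + hs) cc).mem_nhds ((reflect_centre_mem_iff w).2 hw))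
  exact (h1.comp w (hasDerivAt_reflect cc w).differentiableAt).differentiableWithinAt

/-- **Derivative** of `F ∘ ρ`: `(F∘ρ)′(w) = −F′(ρ w)` on the stadium. [folklore] -/
theorem deriv_reflected {E : Type*} [NormedAddCommGroup E] [NormedSpace ℂ E] {hs L cc : ℝ} {F : ℂ → E}
    (hF : DifferentiableOn ℂ F {z : ℂ | |z.im| < hs ∧ |z.re - cc| < L + hs})
    {w : ℂ} (hw : w ∈ {z : ℂ | |z.im| < hs ∧ |z.re - cc| < L + hs}) :
    deriv (fun w => F (2 * (cc : ℂ) - w)) w = -deriv F (2 * (cc : ℂ) - w) := by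
  have h1 : HasDerivAt F (deriv F (2 * (cc : ℂ) - w)) (2 * (cc : ℂ) - w) :=
    (hF.differentiableAt ((isOpen_stadium hs (L + hs) cc).mem_nhds ((reflect_centre_mem_iff w).2 hw))).hasDerivAt
  have h2 : HasDerivAt (fun w => F (2 * (cc : ℂ) - w)) ((-1 : ℂ) • deriv F (2 * (cc : ℂ) - w)) w :=
    h1.scomp w (hasDerivAt_reflect cc w)
  rw [h2.deriv, neg_one_smul]

/-- **Derivative bound** transported. [folklore] -/
theorem reflected_deriv_norm_le {E : Type*} [NormedAddCommGroup E] [NormedSpace ℂ E] {hs L cc M : ℝ} {F : ℂ → E}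
    (hF : DifferentiableOn ℂ F {z : ℂ | |z.im| < hs ∧ |z.re - cc| < L + hs})
    (hM : ∀ z ∈ {z : ℂ | |z.im| < hs ∧ |z.re - cc| < L + hs}, ‖deriv F z‖ ≤ M) :
    ∀ w ∈ {z : ℂ | |z.im| < hs ∧ |z.re - cc| < L + hs}, ‖deriv (fun w => F (2 * (cc : ℂ) - w)) w‖ ≤ M := by
  intro w hw
  rw [deriv_reflected hF hw, norm_neg]
  exact hM _ ((reflect_centre_mem_iff w).2 hw)

/-- **Bilinear unit speed** transported: `Σᵢ ((F∘ρ)′(w))ᵢ² = 1`. [folklore] -/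
theorem reflected_sum_sq_deriv {hs L cc : ℝ} {F : ℂ → (Fin 3 → ℂ)}
    (hF : DifferentiableOn ℂ F {z : ℂ | |z.im| < hs ∧ |z.re - cc| < L + hs})
    (hunit : ∀ w ∈ {z : ℂ | |z.im| < hs ∧ |z.re - cc| < L + hs}, ∑ i, (deriv F w i) ^ 2 = 1) :
    ∀ w ∈ {z : ℂ | |z.im| < hs ∧ |z.re - cc| < L + hs}, ∑ i, (deriv (fun w => F (2 * (cc : ℂ) - w)) w i) ^ 2 = 1 := by
  intro w hw
  rw [deriv_reflected hF hw]
  simp only [Pi.neg_apply, neg_sq]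
  exact hunit _ ((reflect_centre_mem_iff w).2 hw)

/-- **Real trace** transported: `(F∘ρ)(r) = cplx (X (2cc − r))`. [folklore] -/
theorem reflected_real_trace {hs L cc : ℝ} {F : ℂ → (Fin 3 → ℂ)} {X : ℝ → EuclideanSpace ℝ (Fin 3)}
    (hFX : ∀ r : ℝ, (r : ℂ) ∈ {z : ℂ | |z.im| < hs ∧ |z.re - cc| < L + hs} →
      F r = fun i => ((⟪X r, EuclideanSpace.single i (1:ℝ)⟫_ℝ : ℝ) : ℂ)) :
    ∀ r : ℝ, (r : ℂ) ∈ {z : ℂ | |z.im| < hs ∧ |z.re - cc| < L + hs} →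
      (fun w => F (2 * (cc : ℂ) - w)) r = fun i => ((⟪(fun s => X (2 * cc - s)) r, EuclideanSpace.single i (1:ℝ)⟫_ℝ : ℝ) : ℂ) := by
  intro r hr
  have h2 : (((2 * cc - r : ℝ)) : ℂ) ∈ {z : ℂ | |z.im| < hs ∧ |z.re - cc| < L + hs} := by
    rw [← reflect_ofReal]; exact (reflect_centre_mem_iff (r : ℂ)).2 hr
  show F (2 * (cc : ℂ) - r) = _
  rw [reflect_ofReal, hFX _ h2]

/-- **Core-area real trace** transported: `(G∘ρ)(r) = A (2cc − r)`. [folklore] -/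
theorem reflected_area_trace {hs L cc : ℝ} {G : ℂ → ℂ} {A : ℝ → ℝ}
    (hGA : ∀ r : ℝ, (r : ℂ) ∈ {z : ℂ | |z.im| < hs ∧ |z.re - cc| < L + hs} → G r = ((A r : ℝ) : ℂ)) :
    ∀ r : ℝ, (r : ℂ) ∈ {z : ℂ | |z.im| < hs ∧ |z.re - cc| < L + hs} →
      (fun w => G (2 * (cc : ℂ) - w)) r = (((fun s => A (2 * cc - s)) r : ℝ) : ℂ) := by
  intro r hr
  have h2 : (((2 * cc - r : ℝ)) : ℂ) ∈ {z : ℂ | |z.im| < hs ∧ |z.re - cc| < L + hs} := by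
    rw [← reflect_ofReal]; exact (reflect_centre_mem_iff (r : ℂ)).2 hr
  show G (2 * (cc : ℂ) - r) = _
  rw [reflect_ofReal, hGA _ h2]

/-- **Core-area bounds** transported: `A(Re·)/2 ≤ Re G`, `‖G‖ ≤ 2A(Re·)` for the reflected pair. [folklore] -/
theorem reflected_area_bounds {hs L cc : ℝ} {G : ℂ → ℂ} {A : ℝ → ℝ}
    (hGA : ∀ w ∈ {z : ℂ | |z.im| < hs ∧ |z.re - cc| < L + hs}, A w.re / 2 ≤ (G w).re ∧ ‖G w‖ ≤ 2 * A w.re) :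
    ∀ w ∈ {z : ℂ | |z.im| < hs ∧ |z.re - cc| < L + hs},
      (fun s => A (2 * cc - s)) w.re / 2 ≤ ((fun w => G (2 * (cc : ℂ) - w)) w).re ∧
      ‖(fun w => G (2 * (cc : ℂ) - w)) w‖ ≤ 2 * (fun s => A (2 * cc - s)) w.re := by
  intro w hw
  have h := hGA _ ((reflect_centre_mem_iff w).2 hw)
  have hre : (2 * (cc : ℂ) - w).re = 2 * cc - w.re := by simp
  rw [hre] at h
  exact h

/-- **The reversed curve** `s ↦ X (2cc − s)`: differentiable, derivative `−X′(2cc − s)`, unit speed, same tangent oscillation, `C²` if `X` is.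
[folklore] -/
theorem reversed_curve {X : ℝ → EuclideanSpace ℝ (Fin 3)} (hX : Differentiable ℝ X) (cc : ℝ) :
    Differentiable ℝ (fun s => X (2 * cc - s)) ∧
    (∀ s, deriv (fun s => X (2 * cc - s)) s = -deriv X (2 * cc - s)) ∧
    ((∀ τ, ‖deriv X τ‖ = 1) → ∀ s, ‖deriv (fun s => X (2 * cc - s)) s‖ = 1) ∧
    (∀ Rb : ℝ, (∀ τ σ, ‖deriv X τ - deriv X σ‖ ≤ Rb) →
      ∀ τ σ, ‖deriv (fun s => X (2 * cc - s)) τ - deriv (fun s => X (2 * cc - s)) σ‖ ≤ Rb) ∧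
    (ContDiff ℝ 2 X → ContDiff ℝ 2 (fun s => X (2 * cc - s))) := by
  have hρ : ∀ s : ℝ, HasDerivAt (fun s : ℝ => 2 * cc - s) (-1) s := fun s => by
    simpa using (hasDerivAt_id s).const_sub (2 * cc)
  have hd : ∀ s, deriv (fun s => X (2 * cc - s)) s = -deriv X (2 * cc - s) := by
    intro s
    have h : HasDerivAt (fun s => X (2 * cc - s)) ((-1 : ℝ) • deriv X (2 * cc - s)) s :=
      ((hX (2 * cc - s)).hasDerivAt).scomp s (hρ s)
    rw [h.deriv, neg_one_smul]
  refine ⟨fun s => (hX (2 * cc - s)).comp s (hρ s).differentiableAt, hd, ?_, ?_, ?_⟩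
  · intro hu s; rw [hd, norm_neg]; exact hu _
  · intro Rb hosc τ σ
    rw [hd, hd, show -deriv X (2 * cc - τ) - -deriv X (2 * cc - σ) = -(deriv X (2 * cc - τ) - deriv X (2 * cc - σ)) by abel,
      norm_neg]
    exact hosc _ _
  · intro h2
    exact h2.comp ((contDiff_const.sub contDiff_id))

/-! ## §3  The matched-kernel base at reflected target and source -/

/-- **Same kernel base.**  For the reflected pair the matched-kernel base at target `z` and source `ζ` IS the original base at `ρ z`, `ρ ζ` — so a
certificate for `F ∘ ρ, G ∘ ρ` at a right-half target `z` is a certificate for `F, G` at the left-half target `ρ z` (definitional). [folklore] -/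
theorem kernelBase_reflected (F : ℂ → (Fin 3 → ℂ)) (G : ℂ → ℂ) (cc κ : ℝ) (z ζ : ℂ) :
    (∑ i, ((fun w => F (2 * (cc : ℂ) - w)) ζ i - (fun w => F (2 * (cc : ℂ) - w)) z i) ^ 2) + (κ : ℂ) * (fun w => G (2 * (cc : ℂ) - w)) ζ =
      (∑ i, (F (2 * (cc : ℂ) - ζ) i - F (2 * (cc : ℂ) - z) i) ^ 2) + (κ : ℂ) * G (2 * (cc : ℂ) - ζ) := rfl

/-- **Targets.**  A left-half target `x₀ + iY` (`x₀ ≤ cc`) is `ρ` of the right-half target `(2cc − x₀) + i(−Y)` (`cc ≤ 2cc − x₀`), and the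
reflection is an involution. [folklore] -/
theorem left_target_as_reflection (cc x₀ Y : ℝ) :
    (x₀ : ℂ) + (Y : ℂ) * I = 2 * (cc : ℂ) - (((2 * cc - x₀ : ℝ) : ℂ) + ((-Y : ℝ) : ℂ) * I) ∧
    (x₀ ≤ cc → cc ≤ 2 * cc - x₀) ∧ (∀ w : ℂ, 2 * (cc : ℂ) - (2 * (cc : ℂ) - w) = w) := by
  refine ⟨?_, fun h => by linarith, fun w => by ring⟩
  apply Complex.ext <;> simp

end Summit.NavierStokesRegularity.NavierStokesRegularity.Theorems.StadiumCentreReflection
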